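/-
Copyright (c) 2026 the pub-hodgecm-mathlib formalisation cell (harness21).  Prover seat hodgecm-mathlib-K2E3-p25 (g2), HCML Track B «K2-LIT»,
h413 = `stmt-HodgeConjecture-24833`, road (11-3-split-nsc), leaf (nsc-S-A′) `sig_K2E3GL3PrincipalBlockStandardSpan` (U12 :463), brick H0 «THE RULES» (₀₁ family) of the
leaf owner's `K2/K2E3-p25/g2/MEMO-SA-architecture.v2.K2E3-p25-g2.md` §2.  2026-09-04.
-/
import Summits.HodgeConjecture.HodgeConjecture.Theorems.K2E3GL2JacquetPeelingRules      -- ★ PEEL 3∕3: `finrank_weightSpace_le_swap`, `_swap`, `even_finrank_weightSpace_self`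
import Summits.HodgeConjecture.HodgeConjecture.Theorems.K2E3GL3JacquetInStagesBridge     -- ★ BRIDGE (K2E3-p14 (g7)): `finrank_weightSpace_maxParabolicLeviChar_eq_tch`, `exists_linearEquiv_coinvariants_stagesMap`
import Summits.HodgeConjecture.HodgeConjecture.Theorems.K2E3GL3JacquetInStagesBridgePrime  -- ★ BRIDGE′ (K2E3-p14 (g7)): the `P₁₂` twin (ED. 2)
import Literature.NumberTheory.Automorphic.ParabolicInductionModulusProofs               -- ★ `IsSmooth.jacquetGL`, `isOpen_ker_rootDeltaChar_comp_leviEmbeddingP_inv`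
import HarnessLib

/-!
# K2_E3 road (h413), leaf (nsc-S-A′), brick H0 — THE RULES (s₁) AND (par₀₁) OF THE EXPONENT CALCULUS ON `GL₃(F)`

Cell `pub/hodgecm-mathlib` (D-0151), Track B, seat K2E3-p25 (g2) (leaf owner ∕ architect).  `--supports stmt-HodgeConjecture-24833 --as helper`; THEOREMS ONLY
(no `def`, no instance, no notation, no `sorry`); never imports `Cruxes/…/Lines`.  COUNT-NEUTRAL.

CURRENCY (★ H0-a `K2E3GL3PrincipalSeriesExponents`): `T = LB 3 := Π a : Fin 3, GL {i // (id : Fin 3 → Fin 3) i = a} F`, `tch θ := ∏ a, (θ a) ∘ det ∘ ev_a` for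
`θ : Fin 3 → (Fˣ →* ℂˣ)`, `mult V η := finrank ℂ ↥(⨅ m, maxGenEigenspace (normalizedJacquetGL F id V m) (η m))` for a smooth `V : Representation ℂ (GL (Fin 3) F) X` with
finite-dimensional `r_B V`, and `I₂ x y := parabolicIndGL F (lastBlockLabel 2) (𝟙.twist (maxParabolicLeviChar F 2 x y))` (★ G1).

THE RESULTS (for ALL such `V`, in particular every subquotient of every principal series; `x y z` with open kernels):
* §1 glue: a block equivalence `Fin 2 ≃ {i // ![false,false,true] i = false}` over `Fin.castSucc`; the normalised Jacquet module of a smooth representation is smooth;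
  the `GL₁`-block is commutative;
* §2 **`finrank_weightSpace_le_swap₀₁`**: `(I₂ x y).IsIrreducible → mult V ⇑(tch ![x,y,z]) ≤ mult V ⇑(tch ![y,x,z])`;
  **`finrank_weightSpace_swap₀₁`** — RULE (s₁): `I₂ x y`, `I₂ y x` irreducible (e.g. `x, y` unlinked, ★ GL2-UNL) ⇒ `mult V ⇑(tch ![x,y,z]) = mult V ⇑(tch ![y,x,z])`;
  **`even_finrank_weightSpace₀₁`** — RULE (par₀₁): `I₂ x x` irreducible (always, ★ GL2-UNL) ⇒ `mult V ⇑(tch ![x,x,z])` is even.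
PROOF = ★ PEEL (`K2E3GL2JacquetPeelingRules`, Frobenius peeling on the `GL₂`-restriction `W = (r_{P₂₁} V) ∘ ι` with the commuting `GL₁`-block action, no finite length) ∘ ★
BRIDGE (`K2E3GL3JacquetInStagesBridge.finrank_weightSpace_maxParabolicLeviChar_eq_tch`, K2E3-p14 (g7): `mult (r_B V) (tch ![x,y,z])` = the `T₂ × GL₁`-multiplicity of
`(x ⊠ y) ⊗ (z ∘ det)` in `r_{B₂}(W)`).  The (1,2)-twins (s₂), (par₁₂) follow in the sequel once the `P₁₂`-bridge lands.
[BernsteinZelevinsky1977, Prop. 1.9 (c), §2.3, Cor. 2.13, Thm. 2.5; Zelevinsky1980, Thm. 1.9, §3.2 Example p. 181; Casselman1995, §6.3, Lemma 7.1.1]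

HONEST LABEL: HC_CM is proved only modulo the 7 printed citations (2 remaining named inputs: hLiu418 = stmt-HodgeConjecture-24832, h413 = stmt-HodgeConjecture-24833) until rung 0
closes; count-neutral generic helper.

## References
* [BernsteinZelevinsky1977] I. N. Bernstein, A. V. Zelevinsky, *Induced representations of reductive p-adic groups I*, Ann. Sci. ÉNS 10 (1977), Prop. 1.9, §2.3, Cor. 2.13, Thm. 2.5.
* [Zelevinsky1980] A. V. Zelevinsky, *Induced representations of reductive p-adic groups II*, Ann. Sci. ÉNS 13 (1980), Thm. 1.9, §3.2 Example p. 181.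
* [Casselman1995] W. Casselman, *Introduction to the theory of admissible representations of p-adic reductive groups* (draft 1 May 1995), §6.3, Lemma 7.1.1.
-/

set_option autoImplicit false
set_option linter.dupNamespace false

noncomputable section

open Module Module.End Function
open scoped MatrixGroups
open Literature.NumberTheory.Automorphic Literature.NumberTheory.Automorphic.Zelevinsky1980 ValuativeRel
open Summit.HodgeConjecture.HodgeConjecture.Cruxes.H413.K2E3GL2JacquetProdRep
open Summit.HodgeConjecture.HodgeConjecture.Cruxes.H413.K2E3GL2JacquetPeelingRules
open Summit.HodgeConjecture.HodgeConjecture.Cruxes.H413.K2E3GL3JacquetInStagesBridge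

namespace Summit.HodgeConjecture.HodgeConjecture.Cruxes.H413.K2E3GL3ExponentRules

/-! ## §1 Glue: the block equivalence, smoothness of `r_Q V`, commutativity of the `GL₁`-block -/

section Glue

variable {F : Type} [Field F]

/-- The first block `{0, 1}` of the labelling `![false,false,true]` is `Fin 2` along `Fin.castSucc`. [folklore] -/
theorem exists_blockEquiv_twoOne :
    ∃ e : Fin 2 ≃ {i : Fin 3 // (![false, false, true] : Fin 3 → Bool) i = false},
      ∀ j : Fin 2, ((e j : {i : Fin 3 // (![false, false, true] : Fin 3 → Bool) i = false}) : Fin 3) = Fin.castSucc j := by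
  have hmem : ∀ j : Fin 2, (![false, false, true] : Fin 3 → Bool) (Fin.castSucc j) = false := by decide
  let f : Fin 2 → {i : Fin 3 // (![false, false, true] : Fin 3 → Bool) i = false} := fun j => ⟨Fin.castSucc j, hmem j⟩
  have hf : Function.Bijective f := by
    refine ⟨fun a b h => Fin.castSucc_injective _ (congrArg Subtype.val h), fun i => ?_⟩
    obtain ⟨i, hi⟩ := i
    fin_cases i
    · exact ⟨0, rfl⟩
    · exact ⟨1, rfl⟩
    · exact absurd hi (by decide)
  exact ⟨Equiv.ofBijective f hf, fun j => rfl⟩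

/-- The `GL₁`-block `GL {i // ![false,false,true] i = true} F` (a `1 × 1` matrix group) is commutative. [folklore] -/
theorem block_true_mul_comm (d d' : GL {i : Fin 3 // (![false, false, true] : Fin 3 → Bool) i = true} F) : d * d' = d' * d := by
  haveI := K2E3GL3InductionInStagesEmbedding.subsingleton_block_true
  refine Units.ext (Matrix.ext fun i j => ?_)
  rw [Units.val_mul, Units.val_mul, Matrix.mul_apply, Matrix.mul_apply, Fintype.sum_subsingleton _ i, Fintype.sum_subsingleton _ i,
    Subsingleton.elim j i, mul_comm]

variable [ValuativeRel F] [TopologicalSpace F] [IsNonarchimedeanLocalField F]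

/-- **The normalised Jacquet module of a smooth representation is smooth** (★ `IsSmooth.jacquetGL` + the smooth character `(δ^{1∕2} ∘ emb)⁻¹`,
★ `isOpen_ker_rootDeltaChar_comp_leviEmbeddingP_inv`). [cite: BernsteinZelevinsky1977, §1.8, §2.3] -/
theorem isSmooth_normalizedJacquetGL {n : ℕ} {α : Type} [LinearOrder α] [Fintype α] (c : Fin n → α)
    {X : Type} [AddCommGroup X] [Module ℂ X] {V : Representation ℂ (GL (Fin n) F) X} (hV : V.IsSmooth) :
    (Representation.normalizedJacquetGL F c V).IsSmooth := by
  have h1 := Representation.IsSmooth.jacquetGL F c hV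
  have hker : IsOpen ((((rootDeltaChar (standardParabolicGL F c))⁻¹).comp (leviEmbeddingP F c)).ker : Set (Π a, GL {i : Fin n // c i = a} F)) := by
    have heq : ((((rootDeltaChar (standardParabolicGL F c))⁻¹).comp (leviEmbeddingP F c)).ker : Set (Π a, GL {i : Fin n // c i = a} F)) =
        ((((rootDeltaChar (standardParabolicGL F c)).comp (leviEmbeddingP F c))⁻¹).ker : Set (Π a, GL {i : Fin n // c i = a} F)) := by
      ext m
      simp only [SetLike.mem_coe, MonoidHom.mem_ker, MonoidHom.comp_apply, MonoidHom.inv_apply, inv_eq_one]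
    rw [heq]
    exact isOpen_ker_rootDeltaChar_comp_leviEmbeddingP_inv F c
  exact h1.twist hker

end Glue

/-! ## §2 The rules (s₁), (par₀₁) -/

section Rules

variable {F : Type} [Field F] [ValuativeRel F] [TopologicalSpace F] [IsNonarchimedeanLocalField F]
variable {X : Type} [AddCommGroup X] [Module ℂ X]

set_option maxHeartbeats 800000 in  -- elaboration of the long `T₂ × GL₁`-module statements (no search; `whnf` of large Jacquet terms)
/-- **THE ONE-SIDED RULE (s₁)≤.**  For a smooth `V` on `GL₃(F)` with finite-dimensional `r_B V` and characters `x y z` with open kernels: if `I₂ x y` is irreducible then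
`mult V (tch ![x,y,z]) ≤ mult V (tch ![y,x,z])`.  ★ PEEL `finrank_weightSpace_le_swap` on `W = (r_{P₂₁} V) ∘ ι` with the `GL₁`-block action, transported by ★ BRIDGE
`finrank_weightSpace_maxParabolicLeviChar_eq_tch`. [cite: BernsteinZelevinsky1977, Prop. 1.9 (c), Cor. 2.13, Thm. 2.5] [cite: Casselman1995, §6.3, Lemma 7.1.1] -/
theorem finrank_weightSpace_le_swap₀₁ (V : Representation ℂ (GL (Fin 3) F) X) (hV : V.IsSmooth)
    [FiniteDimensional ℂ (Representation.restrictUnipotentGL F (id : Fin 3 → Fin 3) V).Coinvariants]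
    (x y z : Fˣ →* ℂˣ) (hx : IsOpen (x.ker : Set Fˣ)) (hy : IsOpen (y.ker : Set Fˣ))
    (h₁ : (Representation.parabolicIndGL F (lastBlockLabel 2)
      ((Representation.trivial ℂ (Π a : Bool, GL {i : Fin 2 // lastBlockLabel 2 i = a} F) ℂ).twist (maxParabolicLeviChar F 2 x y))).IsIrreducible) :
    finrank ℂ ↥(⨅ m, Module.End.maxGenEigenspace (Representation.normalizedJacquetGL F (id : Fin 3 → Fin 3) V m)
        (((∏ a : Fin 3, ((![x, y, z] : Fin 3 → (Fˣ →* ℂˣ)) a).comp ((Matrix.GeneralLinearGroup.det : GL {i : Fin 3 // (id : Fin 3 → Fin 3) i = a} F →* Fˣ).comp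
          (Pi.evalMonoidHom (fun b : Fin 3 => GL {i : Fin 3 // (id : Fin 3 → Fin 3) i = b} F) a))) m : ℂˣ) : ℂ)) ≤
      finrank ℂ ↥(⨅ m, Module.End.maxGenEigenspace (Representation.normalizedJacquetGL F (id : Fin 3 → Fin 3) V m)
        (((∏ a : Fin 3, ((![y, x, z] : Fin 3 → (Fˣ →* ℂˣ)) a).comp ((Matrix.GeneralLinearGroup.det : GL {i : Fin 3 // (id : Fin 3 → Fin 3) i = a} F →* Fˣ).comp
          (Pi.evalMonoidHom (fun b : Fin 3 => GL {i : Fin 3 // (id : Fin 3 → Fin 3) i = b} F) a))) m : ℂˣ) : ℂ)) := by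
  haveI : IsTopologicalRing F := inferInstance
  obtain ⟨e, he⟩ := exists_blockEquiv_twoOne
  -- the `GL₂`-restriction `W` of `r_Q V` and the commuting `GL₁`-block action `ζ`
  have hQ := isSmooth_normalizedJacquetGL (![false, false, true] : Fin 3 → Bool) hV
  have hcont : Continuous (((MonoidHom.mulSingle (fun a : Bool => GL {i : Fin 3 // (![false, false, true] : Fin 3 → Bool) i = a} F) false).comp
      (reindexGL e).toMonoidHom) : GL (Fin 2) F → (Π a : Bool, GL {i : Fin 3 // (![false, false, true] : Fin 3 → Bool) i = a} F)) :=
    (_root_.continuous_mulSingle false).comp (continuous_reindexGL e)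
  have hW : Representation.IsSmooth ((Representation.normalizedJacquetGL F (![false, false, true] : Fin 3 → Bool) V).comp
      ((MonoidHom.mulSingle (fun a : Bool => GL {i : Fin 3 // (![false, false, true] : Fin 3 → Bool) i = a} F) false).comp (reindexGL e).toMonoidHom) :
        Representation ℂ (GL (Fin 2) F) (Representation.restrictUnipotentGL F (![false, false, true] : Fin 3 → Bool) V).Coinvariants) :=
    IsSmooth.comp_of_continuous _ _ hcont hQ
  have hWζ : ∀ (g : GL (Fin 2) F) (d : GL {i : Fin 3 // (![false, false, true] : Fin 3 → Bool) i = true} F),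
      ((Representation.normalizedJacquetGL F (![false, false, true] : Fin 3 → Bool) V).comp
        ((MonoidHom.mulSingle (fun a : Bool => GL {i : Fin 3 // (![false, false, true] : Fin 3 → Bool) i = a} F) false).comp (reindexGL e).toMonoidHom) :
          Representation ℂ (GL (Fin 2) F) (Representation.restrictUnipotentGL F (![false, false, true] : Fin 3 → Bool) V).Coinvariants) g *
        ((Representation.normalizedJacquetGL F (![false, false, true] : Fin 3 → Bool) V).comp
          (MonoidHom.mulSingle (fun a : Bool => GL {i : Fin 3 // (![false, false, true] : Fin 3 → Bool) i = a} F) true) :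
            Representation ℂ (GL {i : Fin 3 // (![false, false, true] : Fin 3 → Bool) i = true} F) (Representation.restrictUnipotentGL F (![false, false, true] : Fin 3 → Bool) V).Coinvariants) d =
      ((Representation.normalizedJacquetGL F (![false, false, true] : Fin 3 → Bool) V).comp
          (MonoidHom.mulSingle (fun a : Bool => GL {i : Fin 3 // (![false, false, true] : Fin 3 → Bool) i = a} F) true) :
            Representation ℂ (GL {i : Fin 3 // (![false, false, true] : Fin 3 → Bool) i = true} F) (Representation.restrictUnipotentGL F (![false, false, true] : Fin 3 → Bool) V).Coinvariants) d *
        ((Representation.normalizedJacquetGL F (![false, false, true] : Fin 3 → Bool) V).comp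
          ((MonoidHom.mulSingle (fun a : Bool => GL {i : Fin 3 // (![false, false, true] : Fin 3 → Bool) i = a} F) false).comp (reindexGL e).toMonoidHom) :
            Representation ℂ (GL (Fin 2) F) (Representation.restrictUnipotentGL F (![false, false, true] : Fin 3 → Bool) V).Coinvariants) g := by
    intro g d
    change Representation.normalizedJacquetGL F (![false, false, true] : Fin 3 → Bool) V (Pi.mulSingle false (reindexGL e g)) *
        Representation.normalizedJacquetGL F (![false, false, true] : Fin 3 → Bool) V (Pi.mulSingle true d) =
      Representation.normalizedJacquetGL F (![false, false, true] : Fin 3 → Bool) V (Pi.mulSingle true d) *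
        Representation.normalizedJacquetGL F (![false, false, true] : Fin 3 → Bool) V (Pi.mulSingle false (reindexGL e g))
    rw [← map_mul, ← map_mul, (Pi.mulSingle_commute (by decide) _ _).eq]
  obtain ⟨τ, hτ₁, hτ₂⟩ := exists_prodRep _ _ hWζ
  -- finite-dimensionality of `r_{B₂}(W)` through the bridge isomorphism
  obtain ⟨E, -⟩ := exists_linearEquiv_coinvariants_stagesMap e he V
  haveI := Module.Finite.equiv E.symm
  have key := finrank_weightSpace_le_swap block_true_mul_comm _ hW _ hWζ τ hτ₁ hτ₂ x y hx hy h₁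
    (fun d => ((z (Matrix.GeneralLinearGroup.det d) : ℂˣ) : ℂ))
  rw [finrank_weightSpace_maxParabolicLeviChar_eq_tch e he V τ (fun t w => LinearMap.congr_fun (hτ₁ t) w) hτ₂ x y z,
    finrank_weightSpace_maxParabolicLeviChar_eq_tch e he V τ (fun t w => LinearMap.congr_fun (hτ₁ t) w) hτ₂ y x z] at key
  exact key

/-- **RULE (s₁): THE SWAP SYMMETRY IN POSITIONS (0,1).**  For a smooth `V` on `GL₃(F)` with finite-dimensional `r_B V` and characters `x y z` with open kernels: if `I₂ x y`
and `I₂ y x` are irreducible (e.g. `x, y` unlinked, ★ GL2-UNL) then `mult V (tch ![x,y,z]) = mult V (tch ![y,x,z])`.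
[cite: BernsteinZelevinsky1977, Thm. 2.5, Cor. 2.13] [cite: Zelevinsky1980, Thm. 1.9, §3.2 Example p. 181] [cite: Casselman1995, §6.3, Lemma 7.1.1] -/
theorem finrank_weightSpace_swap₀₁ (V : Representation ℂ (GL (Fin 3) F) X) (hV : V.IsSmooth)
    [FiniteDimensional ℂ (Representation.restrictUnipotentGL F (id : Fin 3 → Fin 3) V).Coinvariants]
    (x y z : Fˣ →* ℂˣ) (hx : IsOpen (x.ker : Set Fˣ)) (hy : IsOpen (y.ker : Set Fˣ))
    (h₁ : (Representation.parabolicIndGL F (lastBlockLabel 2)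
      ((Representation.trivial ℂ (Π a : Bool, GL {i : Fin 2 // lastBlockLabel 2 i = a} F) ℂ).twist (maxParabolicLeviChar F 2 x y))).IsIrreducible)
    (h₂ : (Representation.parabolicIndGL F (lastBlockLabel 2)
      ((Representation.trivial ℂ (Π a : Bool, GL {i : Fin 2 // lastBlockLabel 2 i = a} F) ℂ).twist (maxParabolicLeviChar F 2 y x))).IsIrreducible) :
    finrank ℂ ↥(⨅ m, Module.End.maxGenEigenspace (Representation.normalizedJacquetGL F (id : Fin 3 → Fin 3) V m)
        (((∏ a : Fin 3, ((![x, y, z] : Fin 3 → (Fˣ →* ℂˣ)) a).comp ((Matrix.GeneralLinearGroup.det : GL {i : Fin 3 // (id : Fin 3 → Fin 3) i = a} F →* Fˣ).comp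
          (Pi.evalMonoidHom (fun b : Fin 3 => GL {i : Fin 3 // (id : Fin 3 → Fin 3) i = b} F) a))) m : ℂˣ) : ℂ)) =
      finrank ℂ ↥(⨅ m, Module.End.maxGenEigenspace (Representation.normalizedJacquetGL F (id : Fin 3 → Fin 3) V m)
        (((∏ a : Fin 3, ((![y, x, z] : Fin 3 → (Fˣ →* ℂˣ)) a).comp ((Matrix.GeneralLinearGroup.det : GL {i : Fin 3 // (id : Fin 3 → Fin 3) i = a} F →* Fˣ).comp
          (Pi.evalMonoidHom (fun b : Fin 3 => GL {i : Fin 3 // (id : Fin 3 → Fin 3) i = b} F) a))) m : ℂˣ) : ℂ)) :=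
  le_antisymm (finrank_weightSpace_le_swap₀₁ V hV x y z hx hy h₁) (finrank_weightSpace_le_swap₀₁ V hV y x z hy hx h₂)

set_option maxHeartbeats 800000 in  -- as above
/-- **RULE (par₀₁): PARITY IN POSITIONS (0,1).**  For a smooth `V` on `GL₃(F)` with finite-dimensional `r_B V` and characters `x z` with open kernels: if `I₂ x x` is irreducible
(it always is, ★ GL2-UNL) then `mult V (tch ![x,x,z])` is EVEN. [cite: BernsteinZelevinsky1977, Thm. 2.5, Cor. 2.13] [cite: Casselman1995, §6.3, Lemma 7.1.1] -/
theorem even_finrank_weightSpace₀₁ (V : Representation ℂ (GL (Fin 3) F) X) (hV : V.IsSmooth)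
    [FiniteDimensional ℂ (Representation.restrictUnipotentGL F (id : Fin 3 → Fin 3) V).Coinvariants]
    (x z : Fˣ →* ℂˣ) (hx : IsOpen (x.ker : Set Fˣ))
    (h : (Representation.parabolicIndGL F (lastBlockLabel 2)
      ((Representation.trivial ℂ (Π a : Bool, GL {i : Fin 2 // lastBlockLabel 2 i = a} F) ℂ).twist (maxParabolicLeviChar F 2 x x))).IsIrreducible) :
    Even (finrank ℂ ↥(⨅ m, Module.End.maxGenEigenspace (Representation.normalizedJacquetGL F (id : Fin 3 → Fin 3) V m)
        (((∏ a : Fin 3, ((![x, x, z] : Fin 3 → (Fˣ →* ℂˣ)) a).comp ((Matrix.GeneralLinearGroup.det : GL {i : Fin 3 // (id : Fin 3 → Fin 3) i = a} F →* Fˣ).comp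
          (Pi.evalMonoidHom (fun b : Fin 3 => GL {i : Fin 3 // (id : Fin 3 → Fin 3) i = b} F) a))) m : ℂˣ) : ℂ))) := by
  haveI : IsTopologicalRing F := inferInstance
  obtain ⟨e, he⟩ := exists_blockEquiv_twoOne
  have hQ := isSmooth_normalizedJacquetGL (![false, false, true] : Fin 3 → Bool) hV
  have hcont : Continuous (((MonoidHom.mulSingle (fun a : Bool => GL {i : Fin 3 // (![false, false, true] : Fin 3 → Bool) i = a} F) false).comp
      (reindexGL e).toMonoidHom) : GL (Fin 2) F → (Π a : Bool, GL {i : Fin 3 // (![false, false, true] : Fin 3 → Bool) i = a} F)) :=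
    (_root_.continuous_mulSingle false).comp (continuous_reindexGL e)
  have hW : Representation.IsSmooth ((Representation.normalizedJacquetGL F (![false, false, true] : Fin 3 → Bool) V).comp
      ((MonoidHom.mulSingle (fun a : Bool => GL {i : Fin 3 // (![false, false, true] : Fin 3 → Bool) i = a} F) false).comp (reindexGL e).toMonoidHom) :
        Representation ℂ (GL (Fin 2) F) (Representation.restrictUnipotentGL F (![false, false, true] : Fin 3 → Bool) V).Coinvariants) :=
    IsSmooth.comp_of_continuous _ _ hcont hQ
  have hWζ : ∀ (g : GL (Fin 2) F) (d : GL {i : Fin 3 // (![false, false, true] : Fin 3 → Bool) i = true} F),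
      ((Representation.normalizedJacquetGL F (![false, false, true] : Fin 3 → Bool) V).comp
        ((MonoidHom.mulSingle (fun a : Bool => GL {i : Fin 3 // (![false, false, true] : Fin 3 → Bool) i = a} F) false).comp (reindexGL e).toMonoidHom) :
          Representation ℂ (GL (Fin 2) F) (Representation.restrictUnipotentGL F (![false, false, true] : Fin 3 → Bool) V).Coinvariants) g *
        ((Representation.normalizedJacquetGL F (![false, false, true] : Fin 3 → Bool) V).comp
          (MonoidHom.mulSingle (fun a : Bool => GL {i : Fin 3 // (![false, false, true] : Fin 3 → Bool) i = a} F) true) :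
            Representation ℂ (GL {i : Fin 3 // (![false, false, true] : Fin 3 → Bool) i = true} F) (Representation.restrictUnipotentGL F (![false, false, true] : Fin 3 → Bool) V).Coinvariants) d =
      ((Representation.normalizedJacquetGL F (![false, false, true] : Fin 3 → Bool) V).comp
          (MonoidHom.mulSingle (fun a : Bool => GL {i : Fin 3 // (![false, false, true] : Fin 3 → Bool) i = a} F) true) :
            Representation ℂ (GL {i : Fin 3 // (![false, false, true] : Fin 3 → Bool) i = true} F) (Representation.restrictUnipotentGL F (![false, false, true] : Fin 3 → Bool) V).Coinvariants) d *
        ((Representation.normalizedJacquetGL F (![false, false, true] : Fin 3 → Bool) V).comp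
          ((MonoidHom.mulSingle (fun a : Bool => GL {i : Fin 3 // (![false, false, true] : Fin 3 → Bool) i = a} F) false).comp (reindexGL e).toMonoidHom) :
            Representation ℂ (GL (Fin 2) F) (Representation.restrictUnipotentGL F (![false, false, true] : Fin 3 → Bool) V).Coinvariants) g := by
    intro g d
    change Representation.normalizedJacquetGL F (![false, false, true] : Fin 3 → Bool) V (Pi.mulSingle false (reindexGL e g)) *
        Representation.normalizedJacquetGL F (![false, false, true] : Fin 3 → Bool) V (Pi.mulSingle true d) =
      Representation.normalizedJacquetGL F (![false, false, true] : Fin 3 → Bool) V (Pi.mulSingle true d) *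
        Representation.normalizedJacquetGL F (![false, false, true] : Fin 3 → Bool) V (Pi.mulSingle false (reindexGL e g))
    rw [← map_mul, ← map_mul, (Pi.mulSingle_commute (by decide) _ _).eq]
  obtain ⟨τ, hτ₁, hτ₂⟩ := exists_prodRep _ _ hWζ
  obtain ⟨E, -⟩ := exists_linearEquiv_coinvariants_stagesMap e he V
  haveI := Module.Finite.equiv E.symm
  have key := even_finrank_weightSpace_self block_true_mul_comm _ hW _ hWζ τ hτ₁ hτ₂ x hx h (fun d => ((z (Matrix.GeneralLinearGroup.det d) : ℂˣ) : ℂ))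
  rw [finrank_weightSpace_maxParabolicLeviChar_eq_tch e he V τ (fun t w => LinearMap.congr_fun (hτ₁ t) w) hτ₂ x x z] at key
  exact key

end Rules

/-! ## §3 (ED. 2) The rules (s₂), (par₁₂) — the `P₁₂` twins, through ★ BRIDGE′ `K2E3GL3JacquetInStagesBridgePrime` -/

section RulesPrime

variable {F : Type} [Field F]

/-- The second block `{1, 2}` of the labelling `![false,true,true]` is `Fin 2` along `Fin.succ`. [folklore] -/
theorem exists_blockEquiv_oneTwo :
    ∃ e : Fin 2 ≃ {i : Fin 3 // (![false, true, true] : Fin 3 → Bool) i = true},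
      ∀ j : Fin 2, ((e j : {i : Fin 3 // (![false, true, true] : Fin 3 → Bool) i = true}) : Fin 3) = Fin.succ j := by
  have hmem : ∀ j : Fin 2, (![false, true, true] : Fin 3 → Bool) (Fin.succ j) = true := by decide
  let f : Fin 2 → {i : Fin 3 // (![false, true, true] : Fin 3 → Bool) i = true} := fun j => ⟨Fin.succ j, hmem j⟩
  have hf : Function.Bijective f := by
    refine ⟨fun a b h => Fin.succ_injective _ (congrArg Subtype.val h), fun i => ?_⟩
    obtain ⟨i, hi⟩ := i
    fin_cases i
    · exact absurd hi (by decide)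
    · exact ⟨0, rfl⟩
    · exact ⟨1, rfl⟩
  exact ⟨Equiv.ofBijective f hf, fun j => rfl⟩

/-- The `GL₁`-block `GL {i // ![false,true,true] i = false} F` is commutative. [folklore] -/
theorem block_false_mul_comm' (d d' : GL {i : Fin 3 // (![false, true, true] : Fin 3 → Bool) i = false} F) : d * d' = d' * d := by
  haveI : Subsingleton {i : Fin 3 // (![false, true, true] : Fin 3 → Bool) i = false} := ⟨fun a b => Subtype.ext (by
    have ha := a.2; have hb := b.2
    rcases a with ⟨a, _⟩; rcases b with ⟨b, _⟩
    fin_cases a <;> fin_cases b <;> simp_all)⟩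
  refine Units.ext (Matrix.ext fun i j => ?_)
  rw [Units.val_mul, Units.val_mul, Matrix.mul_apply, Matrix.mul_apply, Fintype.sum_subsingleton _ i, Fintype.sum_subsingleton _ i,
    Subsingleton.elim j i, mul_comm]

variable [ValuativeRel F] [TopologicalSpace F] [IsNonarchimedeanLocalField F]
variable {X : Type} [AddCommGroup X] [Module ℂ X]

set_option maxHeartbeats 800000 in  -- as in §2
/-- **THE ONE-SIDED RULE (s₂)≤.**  If `I₂ y z` is irreducible then `mult V (tch ![x,y,z]) ≤ mult V (tch ![x,z,y])` (★ PEEL on `W′ = (r_{P₁₂} V) ∘ ι′`, ★ BRIDGE′).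
[cite: BernsteinZelevinsky1977, Prop. 1.9 (c), Cor. 2.13, Thm. 2.5] [cite: Casselman1995, §6.3, Lemma 7.1.1] -/
theorem finrank_weightSpace_le_swap₁₂ (V : Representation ℂ (GL (Fin 3) F) X) (hV : V.IsSmooth)
    [FiniteDimensional ℂ (Representation.restrictUnipotentGL F (id : Fin 3 → Fin 3) V).Coinvariants]
    (x y z : Fˣ →* ℂˣ) (hy : IsOpen (y.ker : Set Fˣ)) (hz : IsOpen (z.ker : Set Fˣ))
    (h₁ : (Representation.parabolicIndGL F (lastBlockLabel 2)
      ((Representation.trivial ℂ (Π a : Bool, GL {i : Fin 2 // lastBlockLabel 2 i = a} F) ℂ).twist (maxParabolicLeviChar F 2 y z))).IsIrreducible) :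
    finrank ℂ ↥(⨅ m, Module.End.maxGenEigenspace (Representation.normalizedJacquetGL F (id : Fin 3 → Fin 3) V m)
        (((∏ a : Fin 3, ((![x, y, z] : Fin 3 → (Fˣ →* ℂˣ)) a).comp ((Matrix.GeneralLinearGroup.det : GL {i : Fin 3 // (id : Fin 3 → Fin 3) i = a} F →* Fˣ).comp
          (Pi.evalMonoidHom (fun b : Fin 3 => GL {i : Fin 3 // (id : Fin 3 → Fin 3) i = b} F) a))) m : ℂˣ) : ℂ)) ≤
      finrank ℂ ↥(⨅ m, Module.End.maxGenEigenspace (Representation.normalizedJacquetGL F (id : Fin 3 → Fin 3) V m)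
        (((∏ a : Fin 3, ((![x, z, y] : Fin 3 → (Fˣ →* ℂˣ)) a).comp ((Matrix.GeneralLinearGroup.det : GL {i : Fin 3 // (id : Fin 3 → Fin 3) i = a} F →* Fˣ).comp
          (Pi.evalMonoidHom (fun b : Fin 3 => GL {i : Fin 3 // (id : Fin 3 → Fin 3) i = b} F) a))) m : ℂˣ) : ℂ)) := by
  haveI : IsTopologicalRing F := inferInstance
  obtain ⟨e, he⟩ := exists_blockEquiv_oneTwo
  have hQ := isSmooth_normalizedJacquetGL (![false, true, true] : Fin 3 → Bool) hV
  have hcont : Continuous (((MonoidHom.mulSingle (fun a : Bool => GL {i : Fin 3 // (![false, true, true] : Fin 3 → Bool) i = a} F) true).comp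
      (reindexGL e).toMonoidHom) : GL (Fin 2) F → (Π a : Bool, GL {i : Fin 3 // (![false, true, true] : Fin 3 → Bool) i = a} F)) :=
    (_root_.continuous_mulSingle true).comp (continuous_reindexGL e)
  have hW : Representation.IsSmooth ((Representation.normalizedJacquetGL F (![false, true, true] : Fin 3 → Bool) V).comp
      ((MonoidHom.mulSingle (fun a : Bool => GL {i : Fin 3 // (![false, true, true] : Fin 3 → Bool) i = a} F) true).comp (reindexGL e).toMonoidHom) :
        Representation ℂ (GL (Fin 2) F) (Representation.restrictUnipotentGL F (![false, true, true] : Fin 3 → Bool) V).Coinvariants) :=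
    IsSmooth.comp_of_continuous _ _ hcont hQ
  have hWζ : ∀ (g : GL (Fin 2) F) (d : GL {i : Fin 3 // (![false, true, true] : Fin 3 → Bool) i = false} F),
      ((Representation.normalizedJacquetGL F (![false, true, true] : Fin 3 → Bool) V).comp
        ((MonoidHom.mulSingle (fun a : Bool => GL {i : Fin 3 // (![false, true, true] : Fin 3 → Bool) i = a} F) true).comp (reindexGL e).toMonoidHom) :
          Representation ℂ (GL (Fin 2) F) (Representation.restrictUnipotentGL F (![false, true, true] : Fin 3 → Bool) V).Coinvariants) g *
        ((Representation.normalizedJacquetGL F (![false, true, true] : Fin 3 → Bool) V).comp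
          (MonoidHom.mulSingle (fun a : Bool => GL {i : Fin 3 // (![false, true, true] : Fin 3 → Bool) i = a} F) false) :
            Representation ℂ (GL {i : Fin 3 // (![false, true, true] : Fin 3 → Bool) i = false} F) (Representation.restrictUnipotentGL F (![false, true, true] : Fin 3 → Bool) V).Coinvariants) d =
      ((Representation.normalizedJacquetGL F (![false, true, true] : Fin 3 → Bool) V).comp
          (MonoidHom.mulSingle (fun a : Bool => GL {i : Fin 3 // (![false, true, true] : Fin 3 → Bool) i = a} F) false) :
            Representation ℂ (GL {i : Fin 3 // (![false, true, true] : Fin 3 → Bool) i = false} F) (Representation.restrictUnipotentGL F (![false, true, true] : Fin 3 → Bool) V).Coinvariants) d *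
        ((Representation.normalizedJacquetGL F (![false, true, true] : Fin 3 → Bool) V).comp
          ((MonoidHom.mulSingle (fun a : Bool => GL {i : Fin 3 // (![false, true, true] : Fin 3 → Bool) i = a} F) true).comp (reindexGL e).toMonoidHom) :
            Representation ℂ (GL (Fin 2) F) (Representation.restrictUnipotentGL F (![false, true, true] : Fin 3 → Bool) V).Coinvariants) g := by
    intro g d
    change Representation.normalizedJacquetGL F (![false, true, true] : Fin 3 → Bool) V (Pi.mulSingle true (reindexGL e g)) *
        Representation.normalizedJacquetGL F (![false, true, true] : Fin 3 → Bool) V (Pi.mulSingle false d) =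
      Representation.normalizedJacquetGL F (![false, true, true] : Fin 3 → Bool) V (Pi.mulSingle false d) *
        Representation.normalizedJacquetGL F (![false, true, true] : Fin 3 → Bool) V (Pi.mulSingle true (reindexGL e g))
    rw [← map_mul, ← map_mul, (Pi.mulSingle_commute (by decide) _ _).eq]
  obtain ⟨τ, hτ₁, hτ₂⟩ := exists_prodRep _ _ hWζ
  obtain ⟨E, -⟩ := K2E3GL3JacquetInStagesBridgePrime.exists_linearEquiv_coinvariants_stagesMap e he V
  haveI := Module.Finite.equiv E.symm
  have key := finrank_weightSpace_le_swap block_false_mul_comm' _ hW _ hWζ τ hτ₁ hτ₂ y z hy hz h₁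
    (fun d => ((x (Matrix.GeneralLinearGroup.det d) : ℂˣ) : ℂ))
  rw [K2E3GL3JacquetInStagesBridgePrime.finrank_weightSpace_maxParabolicLeviChar_eq_tch e he V τ (fun t w => LinearMap.congr_fun (hτ₁ t) w) hτ₂ x y z,
    K2E3GL3JacquetInStagesBridgePrime.finrank_weightSpace_maxParabolicLeviChar_eq_tch e he V τ (fun t w => LinearMap.congr_fun (hτ₁ t) w) hτ₂ x z y] at key
  exact key

/-- **RULE (s₂): THE SWAP SYMMETRY IN POSITIONS (1,2).**  If `I₂ y z` and `I₂ z y` are irreducible then `mult V (tch ![x,y,z]) = mult V (tch ![x,z,y])`.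
[cite: BernsteinZelevinsky1977, Thm. 2.5, Cor. 2.13] [cite: Zelevinsky1980, Thm. 1.9, §3.2 Example p. 181] [cite: Casselman1995, §6.3, Lemma 7.1.1] -/
theorem finrank_weightSpace_swap₁₂ (V : Representation ℂ (GL (Fin 3) F) X) (hV : V.IsSmooth)
    [FiniteDimensional ℂ (Representation.restrictUnipotentGL F (id : Fin 3 → Fin 3) V).Coinvariants]
    (x y z : Fˣ →* ℂˣ) (hy : IsOpen (y.ker : Set Fˣ)) (hz : IsOpen (z.ker : Set Fˣ))
    (h₁ : (Representation.parabolicIndGL F (lastBlockLabel 2)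
      ((Representation.trivial ℂ (Π a : Bool, GL {i : Fin 2 // lastBlockLabel 2 i = a} F) ℂ).twist (maxParabolicLeviChar F 2 y z))).IsIrreducible)
    (h₂ : (Representation.parabolicIndGL F (lastBlockLabel 2)
      ((Representation.trivial ℂ (Π a : Bool, GL {i : Fin 2 // lastBlockLabel 2 i = a} F) ℂ).twist (maxParabolicLeviChar F 2 z y))).IsIrreducible) :
    finrank ℂ ↥(⨅ m, Module.End.maxGenEigenspace (Representation.normalizedJacquetGL F (id : Fin 3 → Fin 3) V m)
        (((∏ a : Fin 3, ((![x, y, z] : Fin 3 → (Fˣ →* ℂˣ)) a).comp ((Matrix.GeneralLinearGroup.det : GL {i : Fin 3 // (id : Fin 3 → Fin 3) i = a} F →* Fˣ).comp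
          (Pi.evalMonoidHom (fun b : Fin 3 => GL {i : Fin 3 // (id : Fin 3 → Fin 3) i = b} F) a))) m : ℂˣ) : ℂ)) =
      finrank ℂ ↥(⨅ m, Module.End.maxGenEigenspace (Representation.normalizedJacquetGL F (id : Fin 3 → Fin 3) V m)
        (((∏ a : Fin 3, ((![x, z, y] : Fin 3 → (Fˣ →* ℂˣ)) a).comp ((Matrix.GeneralLinearGroup.det : GL {i : Fin 3 // (id : Fin 3 → Fin 3) i = a} F →* Fˣ).comp
          (Pi.evalMonoidHom (fun b : Fin 3 => GL {i : Fin 3 // (id : Fin 3 → Fin 3) i = b} F) a))) m : ℂˣ) : ℂ)) :=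
  le_antisymm (finrank_weightSpace_le_swap₁₂ V hV x y z hy hz h₁) (finrank_weightSpace_le_swap₁₂ V hV x z y hz hy h₂)

set_option maxHeartbeats 800000 in  -- as in §2
/-- **RULE (par₁₂): PARITY IN POSITIONS (1,2).**  If `I₂ y y` is irreducible (always, ★ GL2-UNL) then `mult V (tch ![x,y,y])` is EVEN.
[cite: BernsteinZelevinsky1977, Thm. 2.5, Cor. 2.13] [cite: Casselman1995, §6.3, Lemma 7.1.1] -/
theorem even_finrank_weightSpace₁₂ (V : Representation ℂ (GL (Fin 3) F) X) (hV : V.IsSmooth)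
    [FiniteDimensional ℂ (Representation.restrictUnipotentGL F (id : Fin 3 → Fin 3) V).Coinvariants]
    (x y : Fˣ →* ℂˣ) (hy : IsOpen (y.ker : Set Fˣ))
    (h : (Representation.parabolicIndGL F (lastBlockLabel 2)
      ((Representation.trivial ℂ (Π a : Bool, GL {i : Fin 2 // lastBlockLabel 2 i = a} F) ℂ).twist (maxParabolicLeviChar F 2 y y))).IsIrreducible) :
    Even (finrank ℂ ↥(⨅ m, Module.End.maxGenEigenspace (Representation.normalizedJacquetGL F (id : Fin 3 → Fin 3) V m)
        (((∏ a : Fin 3, ((![x, y, y] : Fin 3 → (Fˣ →* ℂˣ)) a).comp ((Matrix.GeneralLinearGroup.det : GL {i : Fin 3 // (id : Fin 3 → Fin 3) i = a} F →* Fˣ).comp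
          (Pi.evalMonoidHom (fun b : Fin 3 => GL {i : Fin 3 // (id : Fin 3 → Fin 3) i = b} F) a))) m : ℂˣ) : ℂ))) := by
  haveI : IsTopologicalRing F := inferInstance
  obtain ⟨e, he⟩ := exists_blockEquiv_oneTwo
  have hQ := isSmooth_normalizedJacquetGL (![false, true, true] : Fin 3 → Bool) hV
  have hcont : Continuous (((MonoidHom.mulSingle (fun a : Bool => GL {i : Fin 3 // (![false, true, true] : Fin 3 → Bool) i = a} F) true).comp
      (reindexGL e).toMonoidHom) : GL (Fin 2) F → (Π a : Bool, GL {i : Fin 3 // (![false, true, true] : Fin 3 → Bool) i = a} F)) :=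
    (_root_.continuous_mulSingle true).comp (continuous_reindexGL e)
  have hW : Representation.IsSmooth ((Representation.normalizedJacquetGL F (![false, true, true] : Fin 3 → Bool) V).comp
      ((MonoidHom.mulSingle (fun a : Bool => GL {i : Fin 3 // (![false, true, true] : Fin 3 → Bool) i = a} F) true).comp (reindexGL e).toMonoidHom) :
        Representation ℂ (GL (Fin 2) F) (Representation.restrictUnipotentGL F (![false, true, true] : Fin 3 → Bool) V).Coinvariants) :=
    IsSmooth.comp_of_continuous _ _ hcont hQ
  have hWζ : ∀ (g : GL (Fin 2) F) (d : GL {i : Fin 3 // (![false, true, true] : Fin 3 → Bool) i = false} F),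
      ((Representation.normalizedJacquetGL F (![false, true, true] : Fin 3 → Bool) V).comp
        ((MonoidHom.mulSingle (fun a : Bool => GL {i : Fin 3 // (![false, true, true] : Fin 3 → Bool) i = a} F) true).comp (reindexGL e).toMonoidHom) :
          Representation ℂ (GL (Fin 2) F) (Representation.restrictUnipotentGL F (![false, true, true] : Fin 3 → Bool) V).Coinvariants) g *
        ((Representation.normalizedJacquetGL F (![false, true, true] : Fin 3 → Bool) V).comp
          (MonoidHom.mulSingle (fun a : Bool => GL {i : Fin 3 // (![false, true, true] : Fin 3 → Bool) i = a} F) false) :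
            Representation ℂ (GL {i : Fin 3 // (![false, true, true] : Fin 3 → Bool) i = false} F) (Representation.restrictUnipotentGL F (![false, true, true] : Fin 3 → Bool) V).Coinvariants) d =
      ((Representation.normalizedJacquetGL F (![false, true, true] : Fin 3 → Bool) V).comp
          (MonoidHom.mulSingle (fun a : Bool => GL {i : Fin 3 // (![false, true, true] : Fin 3 → Bool) i = a} F) false) :
            Representation ℂ (GL {i : Fin 3 // (![false, true, true] : Fin 3 → Bool) i = false} F) (Representation.restrictUnipotentGL F (![false, true, true] : Fin 3 → Bool) V).Coinvariants) d *
        ((Representation.normalizedJacquetGL F (![false, true, true] : Fin 3 → Bool) V).comp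
          ((MonoidHom.mulSingle (fun a : Bool => GL {i : Fin 3 // (![false, true, true] : Fin 3 → Bool) i = a} F) true).comp (reindexGL e).toMonoidHom) :
            Representation ℂ (GL (Fin 2) F) (Representation.restrictUnipotentGL F (![false, true, true] : Fin 3 → Bool) V).Coinvariants) g := by
    intro g d
    change Representation.normalizedJacquetGL F (![false, true, true] : Fin 3 → Bool) V (Pi.mulSingle true (reindexGL e g)) *
        Representation.normalizedJacquetGL F (![false, true, true] : Fin 3 → Bool) V (Pi.mulSingle false d) =
      Representation.normalizedJacquetGL F (![false, true, true] : Fin 3 → Bool) V (Pi.mulSingle false d) *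
        Representation.normalizedJacquetGL F (![false, true, true] : Fin 3 → Bool) V (Pi.mulSingle true (reindexGL e g))
    rw [← map_mul, ← map_mul, (Pi.mulSingle_commute (by decide) _ _).eq]
  obtain ⟨τ, hτ₁, hτ₂⟩ := exists_prodRep _ _ hWζ
  obtain ⟨E, -⟩ := K2E3GL3JacquetInStagesBridgePrime.exists_linearEquiv_coinvariants_stagesMap e he V
  haveI := Module.Finite.equiv E.symm
  have key := even_finrank_weightSpace_self block_false_mul_comm' _ hW _ hWζ τ hτ₁ hτ₂ y hy h (fun d => ((x (Matrix.GeneralLinearGroup.det d) : ℂˣ) : ℂ))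
  rw [K2E3GL3JacquetInStagesBridgePrime.finrank_weightSpace_maxParabolicLeviChar_eq_tch e he V τ (fun t w => LinearMap.congr_fun (hτ₁ t) w) hτ₂ x y y] at key
  exact key

end RulesPrime

end Summit.HodgeConjecture.HodgeConjecture.Cruxes.H413.K2E3GL3ExponentRules

end
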